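import Mathlib
import HarnessLib

/-!
# `WakeRatchet.TailRatchet` (stmt-NavierStokesRegularity-21808), door D4′ — the EDGE bounds (E) of the fired-chain
# reduction are free: before the first firing of shell `k+1`, shell `k+1` is below the firing level by definition and
# shell `k+2` is below `Λc₀²` by a one-row comparison

Def-free support lemmas (`--supports stmt-NavierStokesRegularity-21808`) for the fired-chain reduction
`WakeRatchetPeakDelaySelfDrain.cauchyPostFiringBound_of_firedChain` (door D4′: (U)+(O)+(L)+(E)+(B) ⟹ (D) ⟹ ¬TailRatchet).
Its input (E) asks, on `[sₖ, sₖ₊₁]` (`s` = first-firing times at level `c₀`), for `Λᵏ⁺¹Xₖ₊₁(τ)(T−τ) ≤ c₁` and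
`Λᵏ⁺²Xₖ₊₂(τ)(T−τ) ≤ c₂` with `c₁c₂ ≤ Λ²c²/2`.  In PHYSICAL time this is elementary for the one-shell cascade
`Ẋₙ = Λⁿ⁻¹Xₙ₋₁² − ΛⁿXₙXₙ₊₁` (`X ≥ 0`, `Xₖ₊₂(0) = 0`):

* `c₁ = c₀`: for `τ ≤ sₖ₊₁` the shell `k+1` has not fired, `Λᵏ⁺¹Xₖ₊₁(τ)(T−τ) ≤ c₀` (definition of the first firing,
  closed at `sₖ₊₁` by continuity) — a hypothesis here;
* `c₂ = Λc₀²` (`second_shell_edge`): while `Λᵏ⁺¹Xₖ₊₁(τ)(T−τ) ≤ c₀` on `[0,b]`, the function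
  `Λᵏ⁺²Xₖ₊₂(τ) − Λc₀²(T−τ)⁻¹` is non-increasing (feed `≤ Λc₀²(T−τ)⁻²`, drain `≥ 0`), so `Λᵏ⁺²Xₖ₊₂(τ)(T−τ) ≤ Λc₀²`;
* and `c₁c₂ = Λc₀³ ≤ Λ²c²/2` holds for the maintained level `c = c₀` as soon as `2c₀ ≤ Λ` (`edge_constants_ok`;
  `c₀ = 1/(2(Λ+Λ⁻¹)) < 1/4`).

So the remaining inputs of door D4′ along this route are (U) unimodality, (O) ordered peaks, (L) level maintenance
`ΛᵏXₖ(τ)(T−τ) ≥ c₀` from first firing to peak, (B) bounded fired-and-rising chain (census CENSUS-21808-leafhand4-g20.md).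

HONEST FRAMING: MODEL lattice ODEs (scalar dyadic member of Tao 2016 §1.2/§4); elementary; nothing about stmt-21808 is
settled, no stub of skeleton d00b85951d7c is closed; rung 0.
-/

noncomputable section

set_option linter.dupNamespace false

namespace Summit.NavierStokesRegularity.NavierStokesRegularity.Theorems

namespace WakeRatchetPeakDelaySelfDrain

open Set

/-- **The second shell above stays below `Λc₀²` before the first firing of the shell above.**  Let `X` solve the dyadic
law for shell `k+2` on `[0,b]` (`b < T`, `Λ > 0`), with `Xₖ₊₂(0) = 0`, `Xₖ₊₁, Xₖ₊₂, Xₖ₊₃ ≥ 0` there, and suppose shell `k+1`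
is below the firing level, `Λᵏ⁺¹Xₖ₊₁(τ)(T−τ) ≤ c₀` on `[0,b]`.  Then `Λᵏ⁺²Xₖ₊₂(τ)(T−τ) ≤ Λc₀²` on `[0,b]`.
[cite: Tao2016AveragedNS, §1.2 (dyadic Katz–Pavlović model), §4 Lemma 4.1 (4.8); elementary (door D4′ of stmt-21808)] -/
theorem second_shell_edge {X : ℤ → ℝ → ℝ} {k : ℤ} {Λ c₀ T b : ℝ} (hΛ : 0 < Λ) (hb : 0 ≤ b)
    (hbT : b < T)
    (hlaw : ∀ τ ∈ Icc 0 b,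
      HasDerivAt (X (k + 2)) (Λ ^ (k + 1) * X (k + 1) τ ^ 2 - Λ ^ (k + 2) * X (k + 2) τ * X (k + 3) τ) τ)
    (hinit : X (k + 2) 0 = 0) (hnn1 : ∀ τ ∈ Icc 0 b, 0 ≤ X (k + 1) τ)
    (hnn2 : ∀ τ ∈ Icc 0 b, 0 ≤ X (k + 2) τ) (hnn3 : ∀ τ ∈ Icc 0 b, 0 ≤ X (k + 3) τ)
    (hedge : ∀ τ ∈ Icc 0 b, Λ ^ (k + 1) * X (k + 1) τ * (T - τ) ≤ c₀) :
    ∀ τ ∈ Icc 0 b, Λ ^ (k + 2) * X (k + 2) τ * (T - τ) ≤ Λ * c₀ ^ 2 := by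
  have hΛ0 : Λ ≠ 0 := hΛ.ne'
  set α : ℝ := Λ ^ (k + 1) with hα
  have hα0 : 0 < α := zpow_pos hΛ _
  have hk2 : Λ ^ (k + 2) = α * Λ := by
    rw [hα, show k + 2 = k + 1 + 1 by ring, zpow_add_one₀ hΛ0]
  -- ψ τ := Λ^(k+2) X_{k+2} τ - Λ c₀² (T-τ)⁻¹ is antitone on [0,b]
  set ψ : ℝ → ℝ := fun τ => Λ ^ (k + 2) * X (k + 2) τ - Λ * c₀ ^ 2 * (T - τ)⁻¹ with hψ
  have hsub : ∀ τ : ℝ, HasDerivAt (fun y => T - y) (-1) τ := fun τ => by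
    simpa using (hasDerivAt_id τ).const_sub T
  have hinv : ∀ τ ∈ Icc 0 b, HasDerivAt (fun y => (T - y)⁻¹) ((T - τ)⁻¹ ^ 2) τ := by
    intro τ hτ
    have hne : T - τ ≠ 0 := by linarith [hτ.2]
    have h := ((hsub τ).inv hne).congr_deriv (by rw [neg_neg, one_div, ← inv_pow])
    exact h
  have hψ' : ∀ τ ∈ Icc 0 b, HasDerivAt ψ
      (Λ ^ (k + 2) * (Λ ^ (k + 1) * X (k + 1) τ ^ 2 - Λ ^ (k + 2) * X (k + 2) τ * X (k + 3) τ)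
        - Λ * c₀ ^ 2 * (T - τ)⁻¹ ^ 2) τ := by
    intro τ hτ
    have h := ((hlaw τ hτ).const_mul (Λ ^ (k + 2))).sub ((hinv τ hτ).const_mul (Λ * c₀ ^ 2))
    exact h.congr_of_eventuallyEq (Filter.Eventually.of_forall fun y => by
      simp only [hψ, Pi.sub_apply])
  have hcont : ContinuousOn ψ (Icc 0 b) := fun τ hτ => (hψ' τ hτ).continuousAt.continuousWithinAt
  have hanti : AntitoneOn ψ (Icc 0 b) := by
    refine antitoneOn_of_hasDerivWithinAt_nonpos
      (f' := fun τ => Λ ^ (k + 2) * (Λ ^ (k + 1) * X (k + 1) τ ^ 2 - Λ ^ (k + 2) * X (k + 2) τ * X (k + 3) τ)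
        - Λ * c₀ ^ 2 * (T - τ)⁻¹ ^ 2) (convex_Icc 0 b) hcont ?_ ?_
    · intro τ hτ
      rw [interior_Icc] at hτ
      exact (hψ' τ (Ioo_subset_Icc_self hτ)).hasDerivWithinAt
    · intro τ hτ
      rw [interior_Icc] at hτ
      have hτ' : τ ∈ Icc 0 b := Ioo_subset_Icc_self hτ
      have hTτ : 0 < T - τ := by linarith [hτ.2]
      have he : α * X (k + 1) τ * (T - τ) ≤ c₀ := hedge τ hτ'
      have hx1 : 0 ≤ α * X (k + 1) τ * (T - τ) := by
        have := hnn1 τ hτ'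
        positivity
      have hsq : (α * X (k + 1) τ * (T - τ)) ^ 2 ≤ c₀ ^ 2 := pow_le_pow_left₀ hx1 he 2
      have hdrain : 0 ≤ Λ ^ (k + 2) * (Λ ^ (k + 2) * X (k + 2) τ * X (k + 3) τ) := by
        have := hnn2 τ hτ'; have := hnn3 τ hτ'; positivity
      -- feed term: Λ^(k+2) α X_{k+1}² = Λ (α X_{k+1})² ≤ Λ c₀² (T-τ)⁻²
      have hfeed : Λ ^ (k + 2) * (α * X (k + 1) τ ^ 2) ≤ Λ * c₀ ^ 2 * (T - τ)⁻¹ ^ 2 := by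
        rw [hk2]
        have e1 : α * Λ * (α * X (k + 1) τ ^ 2) = Λ * ((α * X (k + 1) τ * (T - τ)) ^ 2) * (T - τ)⁻¹ ^ 2 := by
          field_simp
        rw [e1]
        have hi : 0 ≤ (T - τ)⁻¹ ^ 2 := by positivity
        exact mul_le_mul_of_nonneg_right (mul_le_mul_of_nonneg_left hsq hΛ.le) hi
      have e2 : Λ ^ (k + 2) * (Λ ^ (k + 1) * X (k + 1) τ ^ 2 - Λ ^ (k + 2) * X (k + 2) τ * X (k + 3) τ)
          - Λ * c₀ ^ 2 * (T - τ)⁻¹ ^ 2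
          = Λ ^ (k + 2) * (α * X (k + 1) τ ^ 2) - Λ ^ (k + 2) * (Λ ^ (k + 2) * X (k + 2) τ * X (k + 3) τ)
            - Λ * c₀ ^ 2 * (T - τ)⁻¹ ^ 2 := by rw [hα]; ring
      rw [e2]
      linarith
  intro τ hτ
  have hTτ : 0 < T - τ := by linarith [hτ.2]
  have h0 : (0 : ℝ) ∈ Icc 0 b := left_mem_Icc.2 hb
  have hle : ψ τ ≤ ψ 0 := hanti h0 hτ hτ.1
  have hT0 : 0 < T := by linarith
  have hψ0 : ψ 0 ≤ 0 := by
    have e : ψ 0 = -(Λ * c₀ ^ 2 * T⁻¹) := by simp [hψ, hinit]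
    rw [e]
    have : 0 ≤ Λ * c₀ ^ 2 * T⁻¹ := by positivity
    linarith
  have h1 : Λ ^ (k + 2) * X (k + 2) τ ≤ Λ * c₀ ^ 2 * (T - τ)⁻¹ := by
    have := hle.trans hψ0
    simp only [hψ] at this
    linarith
  calc Λ ^ (k + 2) * X (k + 2) τ * (T - τ) ≤ Λ * c₀ ^ 2 * (T - τ)⁻¹ * (T - τ) :=
        mul_le_mul_of_nonneg_right h1 hTτ.le
    _ = Λ * c₀ ^ 2 := by field_simp

/-- **The edge constants fit the self-drain step at the firing level.**  With `c₁ = c₀`, `c₂ = Λc₀²` and the maintained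
level `c = c₀`: `c₁c₂ ≤ Λ²c²/2` as soon as `2c₀ ≤ Λ` (`Λ ≥ 0`) (for `c₀ = 1/(2(Λ+Λ⁻¹))` this is automatic since `c₀ < 1/4 < Λ/2`
when `Λ > 1/2`).
[cite: Tao2016AveragedNS, §1.2 (dyadic model); elementary (door D4′ of stmt-21808)] -/
theorem edge_constants_ok {Λ c₀ : ℝ} (hΛ : 0 ≤ Λ) (h : 2 * c₀ ≤ Λ) :
    c₀ * (Λ * c₀ ^ 2) ≤ Λ ^ 2 * c₀ ^ 2 / 2 := by
  have h1 : 0 ≤ Λ * c₀ ^ 2 := by positivity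
  nlinarith

/-- The firing level `c₀ = 1/(2(Λ+Λ⁻¹))` of door D4′ satisfies `2c₀ ≤ Λ` for every `Λ ≥ 1`.
[cite: Tao2016AveragedNS, §1.2 (dyadic model); elementary (door D4′ of stmt-21808)] -/
theorem two_mul_level_le {Λ : ℝ} (hΛ : 1 ≤ Λ) : 2 * (1 / (2 * (Λ + Λ⁻¹))) ≤ Λ := by
  have hΛ0 : 0 < Λ := by linarith
  have hinv : 0 < Λ⁻¹ := inv_pos.2 hΛ0
  have hsum : 1 ≤ Λ + Λ⁻¹ := by linarith
  rw [show 2 * (1 / (2 * (Λ + Λ⁻¹))) = 1 / (Λ + Λ⁻¹) by field_simp]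
  rw [div_le_iff₀ (by linarith)]
  nlinarith

end WakeRatchetPeakDelaySelfDrain

end Summit.NavierStokesRegularity.NavierStokesRegularity.Theorems

end
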